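import Mathlib
import HarnessLib
import Literature.Analysis.FluidPDE.Tao2016AveragedNS.TaylorChainCertificate

/-!
# Crux K1b-DR (stmt-NavierStokesRegularity-23954), line `taylor-model` — the CERTIFICATE DATA FORMAT and the
# executable checker of the `Chain` block (CERT-CONTRACT-23954 v1, §2–§4)

`stub_certificate` of the line is `∃ d : CertData, d.Valid` (`Theorems/TaylorModelRungThreeDefs.lean`). This module
fixes HOW a concrete `d` is presented to the kernel: finite tables over an exact computable ordered scalar type
`K` (contract: `K = ℚ(√2)` with dyadic coefficients; any `K` with decidable order and a monotone ring map to `ℝ`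
fits the definitions below — the toy certificate uses `K = ℚ`), one record per node / sub-step / stage, window
coordinates coded ARITHMETICALLY (`c = i·m + (k + Kb)`, `m = Ka + Kb + 1` shells; no `Fintype.equivFin`, so that
`decide` evaluates), the interpretation `CertData.ofTables φ T` of the tables as a `CertData` record (functionals as
explicit finite sums, frames and variational jets as matrices acting on window coordinates, junk indices ↦ 0, off-window
weights ↦ 1), and the Boolean CHECKER of the `Chain` block (`checkNode`, `checkStep`, `checkChainStage`,
`checkChain`): every universally quantified clause of `Chain` replaced by the finite test of CERT-CONTRACT §4 (row sums
for boxes/balls, exact identities for jets / variational jets / frame inverses, exact evaluation of the three majorants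
`Rem`, `RemV`, `Dev`, the composite-matrix row-sum test for the Lohner transport clause b21). The entry-polytope clause
and the `Static` / `StageNumerics` / `Readouts` blocks are NOT checked here (their reductions need the Farkas data and the
interval-evaluation lemmas of the contract, §4 ⚠) — `checkChain` covers `Chain` minus the entry clause. SOUNDNESS
(`Chain` from `checkChain = true`) is the subject of the `…CertificateSound*` files, not of this one; this file asserts
nothing.

MODEL-lattice bookkeeping only (rung TL-M3); nothing here is a statement about the Navier–Stokes equations.
-/

-- the sub-problem namespace repeats the summit name by design (D-0017)
set_option linter.dupNamespace false

namespace Summit.NavierStokesRegularity.NavierStokesRegularity.Theorems.TaylorModelCert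

open scoped BigOperators
open Literature.Analysis.FluidPDE.TaoCascade Literature.Analysis.FluidPDE.TaoCascade.TaylorChain

/-! ### List arithmetic over the scalar type -/

section ListOps

variable {K : Type} [Field K] [LinearOrder K]

/-- Entry `c` of a list-coded vector (junk `0`). [folklore] -/
def vget (v : List K) (c : ℕ) : K := v.getD c 0

/-- Entry `(r, c)` of a list-coded matrix (junk `0`). [folklore] -/
def mget (A : List (List K)) (r c : ℕ) : K := (A.getD r []).getD c 0

/-- Dot product of the first `n` entries. [folklore] -/
def dotN (n : ℕ) (u v : ℕ → K) : K := (List.range n).foldr (fun c acc => u c * v c + acc) 0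

/-- Matrix–vector product, list-coded, size `n`. [folklore] -/
def mulVecN (n : ℕ) (A : List (List K)) (v : List K) : List K :=
  (List.range n).map fun r => dotN n (mget A r) (vget v)

/-- Matrix product, list-coded, size `n`. [folklore] -/
def mulMatN (n : ℕ) (A B : List (List K)) : List (List K) :=
  (List.range n).map fun r => (List.range n).map fun c => dotN n (mget A r) (fun t => mget B t c)

/-- Pointwise sum of list-coded vectors, size `n`. [folklore] -/
def addVecN (n : ℕ) (u v : List K) : List K := (List.range n).map fun c => vget u c + vget v c

/-- Pointwise sum of list-coded matrices, size `n`. [folklore] -/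
def addMatN (n : ℕ) (A B : List (List K)) : List (List K) :=
  (List.range n).map fun r => (List.range n).map fun c => mget A r c + mget B r c

/-- Scalar multiple of a list-coded matrix, size `n`. [folklore] -/
def smulMatN (n : ℕ) (a : K) (A : List (List K)) : List (List K) :=
  (List.range n).map fun r => (List.range n).map fun c => a * mget A r c

/-- `∀ c < n, p c` as a Boolean. [folklore] -/
def allN (n : ℕ) (p : ℕ → Bool) : Bool := (List.range n).all p

/-- `Σ_{c<n} f c`. [folklore] -/
def sumN (n : ℕ) (f : ℕ → K) : K := (List.range n).foldr (fun c acc => f c + acc) 0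

end ListOps

/-! ### The tables (CERT-CONTRACT §2) -/

/-- Per-node tables (stage `j`, node `s ≤ S j`): scalars, centre `x`, jets `P n` (`n ≤ pdeg`), box radii `rP`,
frames `Cm`/`Ci` and variational jets `W n` as `n × n` matrices in window coordinates. [folklore] -/
structure NodeTables (K : Type) where
  (Tn mC EI E EO ρ ρO NCi : K)
  x : List K
  P : List (List K)
  rP : List K
  (Cm Ci : List (List K))
  W : List (List (List K))

/-- Per-sub-step tables (stage `j`, sub-step `s < S j`). [folklore] -/
structure StepTables (K : Type) where
  (h mT SpO Sp SpI L1 NV NVh dP κB : K)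

/-- Per-stage tables: weights on the window shells, stage scalars, functionals (`ℓ j l` as window covectors with
`ctr/rad/s/β/NDL`, the section `σf`), nodes and sub-steps. [folklore] -/
structure StageTables (K : Type) where
  S : ℕ
  ω : List K
  (bb κ Λ δ Lv as γ Nσ lev dm ΛX : K)
  nx : ℕ
  ell : List (List K)
  (ctr rad s β NDL : List K)
  σf : List K
  nodes : List (NodeTables K)
  steps : List (StepTables K)

/-- Global tables: window, degree, design constants, datum, envelopes on the shells `[-Kb-1, Ka+1]` (index
`k + Kb + 1`), the structure table `α` on `Fin 4³ × S` (index `((i₁·4 + i₂)·4 + i)·4 + μ`, `μ` in the order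
`(0,0,0),(1,0,0),(0,1,0),(0,0,1)`), and the EFFECTIVE field coefficients
`coef = α · 2^(5(k-μ₃)/2)` per window target shell `k` (index `(α-index)·m + (k + Kb)`), which the checker uses and
whose relation to `α` is a proof obligation of soundness (exact in `ℚ(√2)`). [folklore] -/
structure CertTables (K : Type) where
  (Kb Ka : ℤ)
  (pdeg N₀ : ℕ)
  (R θ c η₀ Cb Cg τs mm : K)
  i₀ : Fin 4
  X₀ : List K
  (M W : List K)
  α : List K
  coef : List K
  stages : List (StageTables K)

namespace CertTables

variable {K : Type} [Field K] [LinearOrder K]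

/-- Number of window shells `m = Ka + Kb + 1`. [folklore] -/
def m (T : CertTables K) : ℕ := (T.Ka + T.Kb + 1).toNat

/-- Number of window coordinates `n = 4m`. [folklore] -/
def n (T : CertTables K) : ℕ := 4 * T.m

/-- Window coordinate of `(i, k)` (meaningful for `-Kb ≤ k ≤ Ka`). [folklore] -/
def idx (T : CertTables K) (i : Fin 4) (k : ℤ) : ℕ := i.val * T.m + (k + T.Kb).toNat

/-- Stage record (junk default beyond the list). [folklore] -/
def stage (T : CertTables K) (j : ℕ) : StageTables K :=
  T.stages.getD j
    { S := 0, ω := [], bb := 0, κ := 0, Λ := 0, δ := 0, Lv := 0, as := 0, γ := 0, Nσ := 0, lev := 0, dm := 0, ΛX := 0,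
      nx := 0, ell := [], ctr := [], rad := [], s := [], β := [], NDL := [], σf := [], nodes := [], steps := [] }

/-- Node record (junk default beyond the list). [folklore] -/
def node (T : CertTables K) (j s : ℕ) : NodeTables K :=
  (T.stage j).nodes.getD s
    { Tn := 0, mC := 0, EI := 0, E := 0, EO := 0, ρ := 0, ρO := 0, NCi := 0, x := [], P := [], rP := [],
      Cm := [], Ci := [], W := [] }

/-- Sub-step record (junk default beyond the list). [folklore] -/
def step (T : CertTables K) (j s : ℕ) : StepTables K :=
  (T.stage j).steps.getD s
    { h := 0, mT := 0, SpO := 0, Sp := 0, SpI := 0, L1 := 0, NV := 0, NVh := 0, dP := 0, κB := 0 }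

/-- Weight of window coordinate `c` at stage `j` (shell `c mod m`). [folklore] -/
def wgt (T : CertTables K) (j c : ℕ) : K := vget (T.stage j).ω (c % T.m)

/-! ### The truncated field in window coordinates over `K` -/

/-- The four shifts of Tao's `S`, in the fixed order of the `α`/`coef` tables. [folklore] -/
def shifts : List (ℤ × ℤ × ℤ) := [(0, 0, 0), (1, 0, 0), (0, 1, 0), (0, 0, 1)]

/-- Effective coefficient `α(i₁,i₂,i,μ)·2^(5(k-μ₃)/2)` for target shell `k` (table look-up). [folklore] -/
def coefAt (T : CertTables K) (i₁ i₂ i : Fin 4) (μi : ℕ) (k : ℤ) : K :=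
  vget T.coef ((((i₁.val * 4 + i₂.val) * 4 + i.val) * 4 + μi) * T.m + (k + T.Kb).toNat)

/-- Window component `(i, k)` of a list-coded vector, zero off the window. [folklore] -/
def comp (T : CertTables K) (y : List K) (i : Fin 4) (k : ℤ) : K :=
  if -T.Kb ≤ k ∧ k ≤ T.Ka then vget y (T.idx i k) else 0

/-- The truncated cascade field `qT` in window coordinates over `K` (target coordinate `(i, k)`). [folklore] -/
def qTK (T : CertTables K) (y : List K) (i : Fin 4) (k : ℤ) : K :=
  sumN 4 fun a => sumN 4 fun b => sumN 4 fun μi =>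
    let μ := shifts.getD μi (0, 0, 0)
    T.coefAt ⟨a % 4, Nat.mod_lt _ (by omega)⟩ ⟨b % 4, Nat.mod_lt _ (by omega)⟩ i μi k *
      (T.comp y ⟨a % 4, Nat.mod_lt _ (by omega)⟩ (k - μ.2.2 + μ.1) *
        T.comp y ⟨b % 4, Nat.mod_lt _ (by omega)⟩ (k - μ.2.2 + μ.2.1))

/-- `qT` as a list-coded vector. [folklore] -/
def qTvec (T : CertTables K) (y : List K) : List K :=
  (List.range T.n).map fun c => T.qTK y ⟨(c / T.m) % 4, Nat.mod_lt _ (by omega)⟩ ((c % T.m : ℕ) - T.Kb)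

/-- The polarised field `Qb(u,v) = (qT(u+v) - qT u - qT v)/2`, list-coded. [folklore] -/
def QbVec (T : CertTables K) (u v : List K) : List K :=
  (List.range T.n).map fun c =>
    (vget (T.qTvec (addVecN T.n u v)) c - vget (T.qTvec u) c - vget (T.qTvec v) c) / 2

/-- Coordinate vector `e_c`. [folklore] -/
def basisVec (T : CertTables K) (c : ℕ) : List K := (List.range T.n).map fun c' => if c' = c then 1 else 0

/-- Matrix of `v ↦ Qb(a, v) + Qb(v, a)` (columns = images of the coordinate vectors). [folklore] -/
def symQbMat (T : CertTables K) (a : List K) : List (List K) :=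
  (List.range T.n).map fun r => (List.range T.n).map fun c =>
    vget (T.QbVec a (T.basisVec c)) r + vget (T.QbVec (T.basisVec c) a) r

/-! ### The three majorants, evaluated exactly -/

/-- `Rem b m u = m q^(p+1)/(1-q)`, `q = b m u`. [folklore] -/
def RemK (T : CertTables K) (b mC u : K) : K := mC * (b * mC * u) ^ (T.pdeg + 1) / (1 - b * mC * u)

/-- `RemV b m u = ((p+2) q^(p+1) - (p+1) q^(p+2))/(1-q)²`. [folklore] -/
def RemVK (T : CertTables K) (b mC u : K) : K :=
  ((((T.pdeg : ℕ) : K) + 2) * (b * mC * u) ^ (T.pdeg + 1) - (((T.pdeg : ℕ) : K) + 1) * (b * mC * u) ^ (T.pdeg + 2)) /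
    (1 - b * mC * u) ^ 2

/-- `Dev b m r u = (m+r)/(1-b(m+r)u) - m/(1-bmu) - r/(1-bmu)²`. [folklore] -/
def DevK (b mC r u : K) : K := (mC + r) / (1 - b * (mC + r) * u) - mC / (1 - b * mC * u) - r / (1 - b * mC * u) ^ 2

/-! ### The checker of the `Chain` block (CERT-CONTRACT §4), per node / sub-step / stage -/

section Check

/-- Weighted row-sum test `Σ_c' |A r c'|·wIn c' ≤ bound r` for all rows `r < n`. [folklore] -/
def rowSumLe (T : CertTables K) (A : List (List K)) (wIn : ℕ → K) (bound : ℕ → K) : Bool :=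
  allN T.n fun r => decide (sumN T.n (fun c => |mget A r c| * wIn c) ≤ bound r)

/-- Exact equality of list-coded vectors on the first `n` entries. [folklore] -/
def vecEq (T : CertTables K) (u v : List K) : Bool := allN T.n fun c => decide (vget u c = vget v c)

/-- Exact equality of list-coded matrices on `n × n`. [folklore] -/
def matEq (T : CertTables K) (A B : List (List K)) : Bool :=
  allN T.n fun r => allN T.n fun c => decide (mget A r c = mget B r c)

/-- Identity matrix, list-coded. [folklore] -/
def idMat (T : CertTables K) : List (List K) :=
  (List.range T.n).map fun r => (List.range T.n).map fun c => if r = c then 1 else 0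

/-- NODE CHECK (clauses a3–a11, a14–a20 of `Chain` at node `(j, s)`; a1/a2/a12/a13 hold by construction):
levels ordered, `|x| ≤ mC·ω`, `rP ≥ 0`, exact frame inverses, the two parallelepiped row-sum tests (a15), the `NCi`
row-sum test (a16), `P 0 = x`, the jet recursion (a18), `W 0 = I`, the variational-jet recursion (a20). [folklore] -/
def checkNode (T : CertTables K) (j s : ℕ) : Bool :=
  let N := T.node j s
  let w : ℕ → K := T.wgt j
  decide (0 ≤ N.mC) && allN T.n (fun c => decide (|vget N.x c| ≤ N.mC * w c)) &&
  allN T.n (fun c => decide (0 ≤ vget N.rP c)) &&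
  decide (0 ≤ N.EI) && decide (N.EI ≤ N.E) && decide (N.E ≤ N.EO) && decide (N.EO ≤ N.ρO) &&
  decide (N.E ≤ N.ρ) && decide (N.ρ ≤ N.ρO) &&
  T.matEq (mulMatN T.n N.Ci N.Cm) T.idMat && T.matEq (mulMatN T.n N.Cm N.Ci) T.idMat &&
  T.rowSumLe N.Cm (vget N.rP) (fun r => (N.ρ - N.E) * w r) &&
  T.rowSumLe N.Cm (vget N.rP) (fun r => (N.ρO - N.EO) * w r) &&
  decide (0 ≤ N.NCi) && T.rowSumLe N.Ci w (fun r => N.NCi * vget N.rP r) &&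
  T.vecEq (N.P.getD 0 []) N.x &&
  allN T.pdeg (fun q => T.vecEq ((List.range T.n).map fun c => (((q : ℕ) : K) + 1) * vget (N.P.getD (q + 1) []) c)
    ((List.range (q + 1)).foldr (fun m' acc => addVecN T.n (T.QbVec (N.P.getD m' []) (N.P.getD (q - m') [])) acc)
      ((List.range T.n).map fun _ => (0 : K)))) &&
  T.matEq (N.W.getD 0 []) T.idMat &&
  allN T.pdeg (fun q => T.matEq (smulMatN T.n (((q : ℕ) : K) + 1) (N.W.getD (q + 1) []))
    ((List.range (q + 1)).foldr (fun m' acc => addMatN T.n (mulMatN T.n (T.symQbMat (N.P.getD m' [])) (N.W.getD (q - m') []))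
      acc) ((List.range T.n).map fun _ => (List.range T.n).map fun _ => (0 : K))))

/-- `Σ_n h^n |P n|_c` (bound for `|TP u|_c`, `u ∈ [0,h]`). [folklore] -/
def tpAbs (T : CertTables K) (N : NodeTables K) (h : K) (c : ℕ) : K :=
  sumN (T.pdeg + 1) fun q => |vget (N.P.getD q []) c| * h ^ q

/-- `Σ_n h^n W_n` (the variational polynomial at `u = h` as one matrix). [folklore] -/
def vapMat (T : CertTables K) (N : NodeTables K) (h : K) : List (List K) :=
  (List.range (T.pdeg + 1)).foldr (fun q acc => addMatN T.n (smulMatN T.n (h ^ q) (N.W.getD q [])) acc)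
    ((List.range T.n).map fun _ => (List.range T.n).map fun _ => (0 : K))

/-- Weighted operator norm test `Σ_c' |A r c'| ω_c' ≤ N·ω_r` for all rows. [folklore] -/
def opNormLe (T : CertTables K) (j : ℕ) (A : List (List K)) (N : K) : Bool :=
  T.rowSumLe A (T.wgt j) (fun r => N * T.wgt j r)

/-- SUB-STEP CHECK (clauses b1–b23 of `Chain` at sub-step `(j, s)`), with the global shell data `M`, `Λ δ τs mm`
entering b23. [folklore] -/
def checkStep (T : CertTables K) (j s : ℕ) : Bool :=
  let G := T.stage j
  let N := T.node j s
  let N' := T.node j (s + 1)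
  let St := T.step j s
  let w : ℕ → K := T.wgt j
  let q : K := G.bb * N.mC * St.h
  let qO : K := G.bb * (N.mC + N.ρO) * St.h
  let qκ : K := G.bb * (St.mT + St.SpO + G.κ) * St.h
  let remh : K := T.RemK G.bb N.mC St.h
  let remVh : K := T.RemVK G.bb N.mC St.h
  decide (0 < St.h) && decide (q < 1) && decide (qO < 1) && decide (N'.Tn = N.Tn + St.h) &&
  allN T.n (fun c => decide (T.tpAbs N St.h c ≤ St.mT * w c)) && decide (0 ≤ St.SpO) &&
  decide (qκ < 1) && decide (1 ≤ St.L1 * (1 - qκ) ^ 2) &&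
  decide (0 ≤ St.NV) &&
  allN T.n (fun r => decide (sumN (T.pdeg + 1) (fun q' => St.h ^ q' *
    sumN T.n (fun c => |mget (N.W.getD q' []) r c| * w c)) ≤ St.NV * w r)) &&
  T.opNormLe j (T.vapMat N St.h) St.NVh &&
  decide (0 ≤ St.NVh) &&
  allN T.n (fun c => decide (|sumN (T.pdeg + 1) (fun q' => vget (N.P.getD q' []) c * St.h ^ q') - vget N'.x c| ≤ St.dP * w c)) &&
  decide (St.NV * N.EI + remh + remVh * N.EI + DevK G.bb N.mC N.EI St.h ≤ St.SpI) &&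
  decide (St.NV * N.ρ + remh + remVh * N.ρ + DevK G.bb N.mC N.ρ St.h ≤ St.Sp) &&
  decide (St.NV * N.ρO + remh + remVh * N.ρO + DevK G.bb N.mC N.ρO St.h + St.L1 * G.κ ≤ St.SpO) &&
  decide (St.dP + St.NVh * N.EI + remh + remVh * N.EI + DevK G.bb N.mC N.EI St.h ≤ N'.EI) &&
  decide (St.dP + St.NVh * N.E + remh + remVh * N.ρ + DevK G.bb N.mC N.ρ St.h ≤ N'.E) &&
  decide (St.dP + St.NVh * N.EO + remh + remVh * N.ρO + DevK G.bb N.mC N.ρO St.h ≤ N'.EO) &&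
  decide (N'.E + St.L1 * G.κ ≤ N'.EO) &&
  T.rowSumLe (mulMatN T.n N'.Ci (mulMatN T.n (T.vapMat N St.h) N.Cm)) (vget N.rP) (vget N'.rP) &&
  decide (N'.NCi * (remVh + (1 / (1 - qO) ^ 2 - 1 / (1 - q) ^ 2)) * (N.ρO - N.EO) ≤ St.κB) &&
  allN T.n (fun c => decide (T.tpAbs N St.h c + St.SpO * w c ≤
    vget T.M (c % T.m + 1) - G.Λ * G.δ * T.τs * w c - T.mm))

/-- STAGE CHECK of the `Chain` block: `1 ≤ S`, `Tn 0 = 0`, `Tn S ≤ τs`, `EI 0 = 0`, the centre `x 0` in the entry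
polytope (faces `l < |ell|`), every node `s ≤ S` and every sub-step `s < S`. The ENTRY-DECOMPOSITION clause is NOT
covered (it needs the Farkas data of CERT-CONTRACT §4). [folklore] -/
def checkChainStage (T : CertTables K) (j : ℕ) : Bool :=
  let G := T.stage j
  decide (1 ≤ G.S) && decide ((T.node j 0).Tn = 0) && decide ((T.node j G.S).Tn ≤ T.τs) &&
  decide ((T.node j 0).EI = 0) &&
  allN G.ell.length (fun l =>
    decide (|sumN T.n (fun c => vget (G.ell.getD l []) c * vget (T.node j 0).x c) - vget G.ctr l| ≤ vget G.rad l)) &&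
  allN (G.S + 1) (fun s => T.checkNode j s) && allN G.S (fun s => T.checkStep j s)

/-- CHAIN CHECK: all stages `j ≤ N₀`. [folklore] -/
def checkChain (T : CertTables K) : Bool := allN (T.N₀ + 1) fun j => T.checkChainStage j

end Check

/-! ### Interpretation of the tables as a `CertData` record (CERT-CONTRACT §2, "generated Lean") -/

section Interp

variable (φ : K →+* ℝ) (T : CertTables K)

/-- A list-coded window vector as a shell state (zero off the window). [folklore] -/
def vecR (v : List K) : Fin 4 → ℤ → ℝ := fun i k => if -T.Kb ≤ k ∧ k ≤ T.Ka then φ (vget v (T.idx i k)) else 0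

/-- A list-coded window matrix as a linear map on shell states (window rows, window columns; zero off the
window). [folklore] -/
def linR (A : List (List K)) (y : Fin 4 → ℤ → ℝ) : Fin 4 → ℤ → ℝ := fun i k =>
  if -T.Kb ≤ k ∧ k ≤ T.Ka then
    ∑ i' : Fin 4, ∑ kk ∈ Finset.range T.m, φ (mget A (T.idx i k) (i'.val * T.m + kk)) * y i' ((kk : ℤ) - T.Kb)
  else 0

/-- A list-coded window covector as an `ℝ`-linear functional on shell states. [folklore] -/
def covR (w : List K) : (Fin 4 → ℤ → ℝ) →ₗ[ℝ] ℝ where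
  toFun y := ∑ i' : Fin 4, ∑ kk ∈ Finset.range T.m, φ (vget w (i'.val * T.m + kk)) * y i' ((kk : ℤ) - T.Kb)
  map_add' y y' := by
    simp only [Pi.add_apply, mul_add, Finset.sum_add_distrib]
  map_smul' r y := by
    simp only [Pi.smul_apply, smul_eq_mul, RingHom.id_apply, Finset.mul_sum]
    refine Finset.sum_congr rfl fun i _ => Finset.sum_congr rfl fun kk _ => by ring

/-- Index of the shift `μ ∈ S` in the table order (junk `4` off `S`). [folklore] -/
def shiftIdx (μ : ℤ × ℤ × ℤ) : ℕ :=
  if μ = (0, 0, 0) then 0 else if μ = (1, 0, 0) then 1 else if μ = (0, 1, 0) then 2 else if μ = (0, 0, 1) then 3 else 4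

/-- **The `CertData` record presented by the tables** (every field an explicit finite expression in the table
entries under `φ : K →+* ℝ`; junk indices ↦ `0`, off-window weights ↦ `1`, the structure table `0` off `S`). [folklore] -/
noncomputable def toCertData : CertData where
  R := φ T.R
  θ := φ T.θ
  c := φ T.c
  η₀ := φ T.η₀
  Cb := φ T.Cb
  Cg := φ T.Cg
  τs := φ T.τs
  mm := φ T.mm
  Kb := T.Kb
  Ka := T.Ka
  i₀ := T.i₀
  α i₁ i₂ i μ := if shiftIdx μ < 4 then φ (vget T.α (((i₁.val * 4 + i₂.val) * 4 + i.val) * 4 + shiftIdx μ)) else 0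
  X₀ i := φ (vget T.X₀ i.val)
  M k := if -T.Kb - 1 ≤ k ∧ k ≤ T.Ka + 1 then φ (vget T.M (k + T.Kb + 1).toNat) else 0
  W k := if -T.Kb - 1 ≤ k ∧ k ≤ T.Ka + 1 then φ (vget T.W (k + T.Kb + 1).toNat) else 0
  N₀ := T.N₀
  pdeg := T.pdeg
  ℓ j l := T.covR φ ((T.stage j).ell.getD l [])
  ctr j l := φ (vget (T.stage j).ctr l)
  rad j l := φ (vget (T.stage j).rad l)
  s j l := φ (vget (T.stage j).s l)
  ω j k := if -T.Kb ≤ k ∧ k ≤ T.Ka then φ (vget (T.stage j).ω (k + T.Kb).toNat) else 1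
  Lv j := φ (T.stage j).Lv
  as j := φ (T.stage j).as
  κ j := φ (T.stage j).κ
  Λ j := φ (T.stage j).Λ
  δ j := φ (T.stage j).δ
  bb j := φ (T.stage j).bb
  γ j := φ (T.stage j).γ
  Nσ j := φ (T.stage j).Nσ
  lev j := φ (T.stage j).lev
  dm j := φ (T.stage j).dm
  ΛX j := φ (T.stage j).ΛX
  nx j := (T.stage j).nx
  S j := (T.stage j).S
  β j l := φ (vget (T.stage j).β l)
  NDL j l := φ (vget (T.stage j).NDL l)
  σf j := T.covR φ (T.stage j).σf
  h j s := φ (T.step j s).h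
  Tn j s := φ (T.node j s).Tn
  mC j s := φ (T.node j s).mC
  mT j s := φ (T.step j s).mT
  EI j s := φ (T.node j s).EI
  E j s := φ (T.node j s).E
  EO j s := φ (T.node j s).EO
  ρ j s := φ (T.node j s).ρ
  ρO j s := φ (T.node j s).ρO
  NVh j s := φ (T.step j s).NVh
  NV j s := φ (T.step j s).NV
  dP j s := φ (T.step j s).dP
  SpI j s := φ (T.step j s).SpI
  Sp j s := φ (T.step j s).Sp
  SpO j s := φ (T.step j s).SpO
  L1 j s := φ (T.step j s).L1
  NCi j s := φ (T.node j s).NCi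
  κB j s := φ (T.step j s).κB
  x j s := T.vecR φ (T.node j s).x
  P j s n := T.vecR φ ((T.node j s).P.getD n [])
  Wv j s n := T.linR φ ((T.node j s).W.getD n [])
  Cm j s := T.linR φ (T.node j s).Cm
  Ci j s := T.linR φ (T.node j s).Ci
  rP j s := T.vecR φ (T.node j s).rP

end Interp

end CertTables

end Summit.NavierStokesRegularity.NavierStokesRegularity.Theorems.TaylorModelCert
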